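/-
COR-CM (cells pub-hodgecm / pub-hodgecm2, stage 2 of the Hodge ladder) — HM-EQUALITY Δ2: the ONE-THEOREM bridge
«[Liu 2021, Thm. 4.18] AS PRINTED (at the Appendix-C datum, one datum per character `μ`) + the proof's realisation pins ⟹ the
package's combined reading r8 `LiuAlbaneseModuleDatum.Thm418Combined res cmCl`» (pin-3 = prover-pub-hodgecm2-pin-3-g2-0; Δ2 co-owner
per COORDINATOR RULING 2026-08-21T19:17:21Z).  A pure COMPOSITION BY NAME of item6-p2's (J3) placement junction
`LiuAlbaneseModuleDatum.thm418Combined_of_realised_rankOne` and adapter `LiuAlbaneseModuleDatum.thm418Realised_of_asPrinted`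
(`Transposition/Item6PlacementJunction.lean`, p305984 ✔) at the Appendix-C presentation `toThm418Data C (R μ)` of liuC-typer-4's
`AppendixC/Glue.lean` (p293186 ✔) — the presentation in which ALL data `D_μ` share ONE group `𝔾(𝔸_F^∞) = P5.G` and ONE tower
`X_K`, `A_K = Alb_{X_K}` (§4.2), as in the paper.  Theorems only: no definition, no instance, no named fact, no `variable`, no proof
holes; nothing landed is edited or restated.  FRAMING: HC_CM is NOT proved; this file discharges no COR-CM binder and no pin.
-/
import Summits.HodgeConjecture.CorCM.B01.Transposition.Item6PlacementJunction
import Literature.NumberTheory.Automorphic.Liu2021.AppendixC.Glue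
import HarnessLib

set_option autoImplicit false

/-!
# Δ2 in one theorem: `Thm418AsPrintedC C (R μ)` for every `μ` with `τ' ∈ Φ_μ` + realisation pins ⟹ `T.Thm418Combined res cmCl`

WHAT IS COMPARED.  The package leaf cited by the hM-side facts is `h418 : (liuDictionaryPin …).Thm418C` with
`LiuDictionary.Thm418C := T.Thm418Combined T.res T.cmClasses` (package `HodgeCM/Model/LiuDictionary.lean` :210; COMBINED READING r8 of
[Liu2021] Thm. 4.18 + its proof map + item (1) + Lem. 2.4 (1), over the real-carrier record `LiuAlbaneseModuleDatum G Kof` of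
`HodgeCM/Literature/AlbaneseUnitaryShimuraModules.lean`, PORTED VERBATIM to the tree as
`Summits/HodgeConjecture/HodgeCM/Literature/AlbaneseUnitaryShimuraModules.lean`).  The tree's statement-exact typing is
`Liu2021.Thm418AsPrinted D` (`Literature/NumberTheory/Automorphic/Liu2021/Thm418AsPrinted.lean`, p277833 ✔; `FJcycle.tex` l. 2232–2245).

WHAT THIS FILE PROVES (`LiuAlbaneseModuleDatum.thm418Combined_of_thm418AsPrintedC`).  For ANY record `T : LiuAlbaneseModuleDatum P5.G Kof`
over the group `𝔾(𝔸_F^∞) = P5.G` of an Appendix-C datum (Prop. C.5, l. 4624–4637; `PropC5Data`), any geometric side `res`/`cmCl`, a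
monotone cofinal family of open compact levels `Kof`, ONE §4.2 datum `C : Sec42Data P5 iso` (the tower `X_K = S̃h(𝕍)_K`, `A_K := Alb_{X_K}`
over `E`, l. 2053–2074) and, for every character `μ` of `T` with `τ' ∈ Φ_μ`, the rest of Thm. 4.18's data `R μ : Thm418Rest C`
(`μ`, `ω(μ,ε,χ)`, `Ω(μ)`, the objects `D_μ ∈ 𝒜(μ)` with «`A_μ` is an abelian variety over `E`» Def. 4.5 (2) l. 1946, the canonical maps
`Hom_E(A_K, A_μ)_ℚ → Ω(μ)`):
* `hLiu μ` — [Liu2021] Thm. 4.18 EXACTLY AS PRINTED for the datum `toThm418Data C (R μ)` (`Thm418AsPrintedC`);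
* (Ω) `ψ μ`/`hψ μ` — `T`'s `μ`-pieces `ω(μ,a)` ARE Liu's summands `ω(μ,ε,χ)`, `𝔾(𝔸_F^∞)`-equivariantly (a `ℂ`-linear identification of
  the two direct sums intertwining the actions);
* (J) `J μ`/`hJ μ`/`hJinj μ` — THE PROOF'S MAP (4.2)/(4.3) «`f ⊗ z ↦ z · f^*α`» into `H = H¹_{B,τ'}(A_∞, ℂ)` (l. 2247–2266), «`ℂ[𝔾(𝔸_F^∞)]`-linear»
  (l. 2250) and injective (a READING of the proof chain l. 2250–2268; record `Liu2021/Thm418ProofMapAsPrinted.lean`, item6-p1, with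
  injectivity a THEOREM of linear algebra in `Liu2021/Map43Injective.lean`, tr-prover-6);
* `Dμ μ` — an object of `𝒜(μ)` (Prop. 4.6 (1) l. 1969) and (C) `hpin μ` — the class `f^*α`, `f ∈ Hom_E(A_K, A_μ)_ℚ`, restricted to the
  consumer's `W K`, IS one of the consumer's CM classes (Lem. 2.4 (1) l. 1210–1213 + Betti functoriality + the contract on `cmCl`);
* `hnv` — every `ω(μ,a) ≠ 0` (Def. 4.11 l. 2092–2096 with App. D Lem. D.1 (1)); `hmult` — MULTIPLICITY ONE, proof of Prop. 4.13 l. 2145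
  «the dimension of `H¹_{B,τ'}(A_∞, ℂ)[ω(μ,ε,χ)]` is `1`» (record `Prop413MultOneAsPrinted`, tr-prover-6, transported to `T`'s pieces by
  item6-p2's `rank_hom_le_one_of_equiv`);
one obtains `T.Thm418Combined res cmCl` — hence, at the port's `T := (liuDictionaryPin …).toLiuAlbaneseModuleDatum`, `res := T.res`,
`cmCl := T.cmClasses` (group `↥V.adelicFin = (honestP5Of h …).G` by `rfl`, TEAM hComp `HComp/HonestP5Of.lean`), LITERALLY `Thm418C`.
KERNEL: `thm418Combined_of_realised_rankOne hnv hmult (fun μ hμ ↦ thm418Realised_of_asPrinted (toThm418Data C (R μ hμ)) …)` — the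
Appendix-C presentation is what makes the family of data share `P5.G` DEFINITIONALLY (`Sec42Data.toThm418Data_G`, `rfl`), so that
item6-p2's single-`μ` adapter (stated for a record over `D.G`) applies at every `μ` to ONE record `T`.
WHAT REMAINS of Δ2 after this file (unchanged, now visible in ONE binder list): the instance pins (Ω), (J), (C) and the two printed
sentences `hnv`/`hmult` at the package's `liuDictionaryPin` (port layers L45/L67), and the port itself.  HC_CM is NOT proved.

References: Y. Liu, arXiv:2102.11518 = Camb. J. Math. 9 (2021) (`FJcycle.tex` md5 6db49a74122d): Lem. 2.4 l. 1210–1213, Def. 4.5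
l. 1936–1964, Prop. 4.6 (1) l. 1969, §4.2 l. 2053–2074, Def. 4.11 l. 2083–2097, Prop. 4.13 l. 2113–2119 (proof l. 2145), Thm. 4.18
l. 2232–2245 (proof l. 2247–2268), App. C Prop. C.5 l. 4624–4637.
-/

noncomputable section

open scoped DirectSum TensorProduct

namespace HodgeCM.Literature.Theta

namespace LiuAlbaneseModuleDatum

open Literature.NumberTheory.Automorphic.Liu2021 Literature.NumberTheory.Automorphic.Liu2021.AppendixC NumberField

universe v w

/-- **Δ2 IN ONE THEOREM — [Liu2021, Thm. 4.18] AS PRINTED at the Appendix-C datum (one `Thm418Rest` per character) + the proof's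
realisation pins ⟹ the package's combined reading r8 `T.Thm418Combined res cmCl`** (= `LiuDictionary.Thm418C` at `res := T.res`,
`cmCl := T.cmClasses`).  Binders: the record `T` over `𝔾(𝔸_F^∞) = P5.G` with its geometric side `res`/`cmCl`; the levels `Kof` (monotone
`hmono`, open compact `hoc`, cofinal `hcof` — «sufficiently small», l. 2060/2239); ONE §4.2 datum `C` (l. 2053–2074) and per `μ` with
`τ' ∈ Φ_μ` the data `R μ` (Def. 4.5 (2) l. 1944–1952, Def. 4.11, Def. 4.16); `hLiu` = Thm. 4.18 EXACTLY AS PRINTED (l. 2232–2245) for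
`toThm418Data C (R μ)`; (Ω) `ψ`/`hψ`; (J) the proof map (4.2)/(4.3) `J` with `hJ` (l. 2250) and `hJinj` (reading of l. 2250–2268); `Dμ`
(Prop. 4.6 (1)); (C) `hpin` (Lem. 2.4 (1) l. 1210–1213); `hnv` (Def. 4.11 / Lem. D.1 (1)); `hmult` (proof of Prop. 4.13, l. 2145).  KERNEL:
item6-p2's `thm418Combined_of_realised_rankOne` ∘ `thm418Realised_of_asPrinted` (p305984), per `μ`, at `D := toThm418Data C (R μ hμ)`
whose group is `P5.G` by `rfl`.  HC_CM is NOT proved; no pin is discharged here; nothing is asserted about Liu's objects.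
[cite: Liu2021, Thm. 4.18 (FJcycle.tex l. 2232–2245) with proof l. 2247–2268, Thm. 4.18 (1) (l. 2239), Lem. 2.4 (1) (l. 1210–1213), Prop. 4.13 proof l. 2145, Def. 4.11, §4.2 l. 2053–2074, Prop. C.5 (l. 4624–4637)] -/
theorem thm418Combined_of_thm418AsPrintedC
    {F E : Type} [Field F] [NumberField F] [IsTotallyReal F] [Field E] [NumberField E] [Algebra F E]
    [IsTotallyComplex E] [Algebra.IsQuadraticExtension F E]
    {P5 : PropC5Data F E} {isotropicAt : ℕ → Prop} (C : Sec42Data P5 isotropicAt)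
    {Lvl : Type v} [Preorder Lvl] {Kof : Lvl → Subgroup P5.G} (T : LiuAlbaneseModuleDatum P5.G Kof)
    {W : Lvl → Type w} [∀ K, AddCommGroup (W K)] [∀ K, Module ℂ (W K)]
    (res : ∀ K : Lvl, T.H →ₗ[ℂ] W K) (cmCl : ∀ K : Lvl, T.Char → Set (W K))
    (hmono : ∀ ⦃K K' : Lvl⦄, K ≤ K' → Kof K ≤ Kof K') (hoc : ∀ K : Lvl, IsOpenCompact (Kof K))
    (hcof : ∀ K₀ : Subgroup P5.G, IsOpenCompact K₀ → ∃ K₁ : Lvl, Kof K₁ ≤ K₀)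
    (R : ∀ μ : T.Char, T.PhiMu μ → Thm418Rest C)
    (hLiu : ∀ (μ : T.Char) (hμ : T.PhiMu μ), Thm418AsPrintedC C (R μ hμ))
    (ψ : ∀ (μ : T.Char) (hμ : T.PhiMu μ),
      (⨁ a : T.Adm μ, T.Ω μ a) ≃ₗ[ℂ] ⨁ i : (toThm418Data C (R μ hμ)).AdmIndex, (toThm418Data C (R μ hμ)).omegaAt i)
    (hψ : ∀ (μ : T.Char) (hμ : T.PhiMu μ) (g : P5.G) (y : ⨁ a : T.Adm μ, T.Ω μ a) (i : (toThm418Data C (R μ hμ)).AdmIndex),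
      ψ μ hμ (MonoidAlgebra.of ℂ P5.G g • y) i = (toThm418Data C (R μ hμ)).rhoAt i g (ψ μ hμ y i))
    (J : ∀ (μ : T.Char) (hμ : T.PhiMu μ),
      ℂ ⊗[fieldOfValues E (toThm418Data C (R μ hμ)).μ] (toThm418Data C (R μ hμ)).Ω →ₗ[ℂ] T.H)
    (hJinj : ∀ (μ : T.Char) (hμ : T.PhiMu μ), Function.Injective (J μ hμ))
    (hJ : ∀ (μ : T.Char) (hμ : T.PhiMu μ) (g : P5.G) (x : ℂ ⊗[fieldOfValues E (toThm418Data C (R μ hμ)).μ] (toThm418Data C (R μ hμ)).Ω),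
      J μ hμ (((toThm418Data C (R μ hμ)).rhoΩ g).baseChange ℂ x) = MonoidAlgebra.of ℂ P5.G g • J μ hμ x)
    (Dμ : ∀ (μ : T.Char) (hμ : T.PhiMu μ), (toThm418Data C (R μ hμ)).Obj)
    (hpin : ∀ (μ : T.Char) (hμ : T.PhiMu μ) (K : Lvl) (φ : (toThm418Data C (R μ hμ)).HomK (Kof K) (Dμ μ hμ)),
      res K (J μ hμ ((1 : ℂ) ⊗ₜ[fieldOfValues E (toThm418Data C (R μ hμ)).μ] (toThm418Data C (R μ hμ)).res (Kof K) (Dμ μ hμ) φ))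
        ∈ cmCl K μ)
    (hnv : ∀ (μ : T.Char) (a : T.Adm μ), Nontrivial (T.Ω μ a))
    (hmult : ∀ (μ : T.Char) (a : T.Adm μ), Module.rank ℂ (T.Ω μ a →ₗ[MonoidAlgebra ℂ P5.G] T.H) ≤ 1) :
    T.Thm418Combined res cmCl :=
  thm418Combined_of_realised_rankOne hnv hmult fun μ hμ =>
    thm418Realised_of_asPrinted (toThm418Data C (R μ hμ)) (T := T) (hLiu μ hμ) hmono hoc hcof (ψ μ hμ) (hψ μ hμ)
      (J μ hμ) (hJinj μ hμ) (hJ μ hμ) (Dμ μ hμ) (hpin μ hμ)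

end LiuAlbaneseModuleDatum

end HodgeCM.Literature.Theta

end
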